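import Summits.Ventures.HodgeRepro2.T5BergmanCoefficientL2
import Summits.Ventures.HodgeRepro2.T5SU11Cartan

/-!
# The infinitesimal action on the `K`-types: the ladder operators of the weighted Bergman model

The three one-parameter subgroups of `SU(1,1)` — the rotations `rot (e^{it})`, the hyperbolic
`a_t = su11 (cosh t) (sinh t)` (`T5SU11Cartan.hyp`) and `b_t = su11 (cosh t) (i sinh t)` (`hypB`) — act
on the monomials `zⁿ` of the weight-`k` model (`T5BergmanCoefficient.act`) by explicit formulas
(`act_hyp_monomial`, `act_hypB_monomial`, `T5BergmanCoefficientL2.act_rot_monomial`), and the derivatives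
at `t = 0` are

  `d/dt π_k(rot e^{it}) zⁿ = -i (k + 2n) zⁿ`,
  `d/dt π_k(a_t) zⁿ = (k + n) z^{n+1} - n z^{n-1}`,
  `d/dt π_k(b_t) zⁿ = -i ((k + n) z^{n+1} + n z^{n-1})`

(`hasDerivAt_act_rot_exp_monomial`, `hasDerivAt_act_hyp_monomial`, `hasDerivAt_act_hypB_monomial`).  Hence
the complex combinations `E₊ = ½ (∂_a + i ∂_b)` and `E₋ = ½ (∂_a - i ∂_b)` act as the LADDER OPERATORS

  `E₊ zⁿ = (k + n) z^{n+1}`,   `E₋ zⁿ = -n z^{n-1}`,   `H zⁿ = (k + 2n) zⁿ`   (`H = i ∂_rot`),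

with `E₋ 1 = 0` (lowest weight), `[E₊, E₋] zⁿ = H zⁿ` and the Casimir-type identities
`E₊ E₋ zⁿ = -n (k + n - 1) zⁿ`, `E₋ E₊ zⁿ = -(n + 1)(k + n) zⁿ` (`raise_lower_monomial`, `lower_raise_monomial`,
`commutator_monomial`): the explicit model IS the lowest-weight `𝔰𝔩₂`-module of lowest weight `k`
(Rühl's `(k_R, +)`, `k = 2 k_R`) at the Lie-algebra level, generated from the lowest-weight vector `1`
by `E₊` (`raise_iterate_lowest`).  The abstract lowest-weight `𝔰𝔩₂`-module of `T5Sl2LowestWeightModel`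
(gen 15, rows 103–110) is the same ladder written on `ℕ →₀ K`; the identification of the two as Lie
modules (the derivative action on all of `A_k` rather than on the monomials) is NOT claimed here.

Blind lane: Mathlib + the HodgeRepro2 prefix only; no sorry; axioms ⊆ {propext, Classical.choice,
Quot.sound}.
-/

namespace Summit.Ventures.HodgeRepro2.T5BergmanLadder

open T5PoincareDensity T5SU11Unimodular T5SU11Fibration T5BergmanCoefficient T5BergmanCoefficientL2
  T5SU11Cartan
open scoped Real

/-! ### The hyperbolic subgroups and their action on monomials -/

/-- `cosh² t - |i sinh t|² = 1`. -/
lemma normSq_cosh_sub_normSq_I_mul_sinh (t : ℝ) :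
    Complex.normSq (Real.cosh t : ℂ) - Complex.normSq (Complex.I * (Real.sinh t : ℂ)) = 1 := by
  rw [Complex.normSq_mul, Complex.normSq_I, one_mul, Complex.normSq_ofReal, Complex.normSq_ofReal,
    ← sq, ← sq]
  exact Real.cosh_sq_sub_sinh_sq t

/-- The second hyperbolic one-parameter subgroup `b_t = su11 (cosh t) (i sinh t)`. -/
noncomputable def hypB (t : ℝ) : SU11 :=
  toSU11 (Real.cosh t : ℂ) (Complex.I * (Real.sinh t : ℂ)) (normSq_cosh_sub_normSq_I_mul_sinh t)

/-- The matrix of `b_t`. -/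
lemma mat_hypB (t : ℝ) : mat (hypB t) = su11 (Real.cosh t : ℂ) (Complex.I * (Real.sinh t : ℂ)) :=
  coe_toSU11 _ _ _

/-- `mat (a_t)⁻¹ = su11 (cosh t) (-sinh t)`. -/
lemma mat_hyp_inv (t : ℝ) : mat (hyp t)⁻¹ = su11 (Real.cosh t : ℂ) (-(Real.sinh t : ℂ)) := by
  rw [mat_inv, mat_hyp]
  have e00 : su11 (Real.cosh t : ℂ) (Real.sinh t : ℂ) 0 0 = (Real.cosh t : ℂ) := rfl
  have e01 : su11 (Real.cosh t : ℂ) (Real.sinh t : ℂ) 0 1 = (Real.sinh t : ℂ) := rfl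
  rw [e00, e01, Complex.conj_ofReal]

/-- `mat (b_t)⁻¹ = su11 (cosh t) (-i sinh t)`. -/
lemma mat_hypB_inv (t : ℝ) :
    mat (hypB t)⁻¹ = su11 (Real.cosh t : ℂ) (-(Complex.I * (Real.sinh t : ℂ))) := by
  rw [mat_inv, mat_hypB]
  have e00 : su11 (Real.cosh t : ℂ) (Complex.I * (Real.sinh t : ℂ)) 0 0 = (Real.cosh t : ℂ) := rfl
  have e01 : su11 (Real.cosh t : ℂ) (Complex.I * (Real.sinh t : ℂ)) 0 1 =
      Complex.I * (Real.sinh t : ℂ) := rfl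
  rw [e00, e01, Complex.conj_ofReal]

/-- **`a_t` on monomials**: `(π_k(a_t) zⁿ)(w) = (cosh t - sinh t · w)^{-(k+n)} (cosh t · w - sinh t)ⁿ`. -/
theorem act_hyp_monomial (k n : ℕ) (t : ℝ) (w : ℂ) :
    act k (hyp t) (fun z => z ^ n) w =
      ((Real.cosh t : ℂ) - (Real.sinh t : ℂ) * w)⁻¹ ^ (k + n) *
        ((Real.cosh t : ℂ) * w - (Real.sinh t : ℂ)) ^ n := by
  unfold act
  rw [mat_hyp_inv, denom_su11, mobius_su11]
  simp only [map_neg, Complex.conj_ofReal, neg_mul]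
  rw [div_pow, pow_add, div_eq_mul_inv, ← inv_pow]
  ring_nf

/-- **`b_t` on monomials**: `(π_k(b_t) zⁿ)(w) = (cosh t + i sinh t · w)^{-(k+n)} (cosh t · w - i sinh t)ⁿ`. -/
theorem act_hypB_monomial (k n : ℕ) (t : ℝ) (w : ℂ) :
    act k (hypB t) (fun z => z ^ n) w =
      ((Real.cosh t : ℂ) + Complex.I * (Real.sinh t : ℂ) * w)⁻¹ ^ (k + n) *
        ((Real.cosh t : ℂ) * w - Complex.I * (Real.sinh t : ℂ)) ^ n := by
  unfold act
  rw [mat_hypB_inv, denom_su11, mobius_su11]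
  simp only [map_neg, map_mul, Complex.conj_ofReal, Complex.conj_I, neg_mul, neg_neg]
  rw [div_pow, pow_add, div_eq_mul_inv, ← inv_pow]
  ring_nf

/-! ### The derivatives at `t = 0` -/

/-- `t ↦ (cosh t : ℂ)` has derivative `sinh t`. -/
lemma hasDerivAt_cosh_ofReal (t : ℝ) :
    HasDerivAt (fun t : ℝ => (Real.cosh t : ℂ)) (Real.sinh t : ℂ) t :=
  (Real.hasDerivAt_cosh t).ofReal_comp

/-- `t ↦ (sinh t : ℂ)` has derivative `cosh t`. -/
lemma hasDerivAt_sinh_ofReal (t : ℝ) :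
    HasDerivAt (fun t : ℝ => (Real.sinh t : ℂ)) (Real.cosh t : ℂ) t :=
  (Real.hasDerivAt_sinh t).ofReal_comp

/-- **The hyperbolic generator on monomials**: `d/dt|₀ π_k(a_t) zⁿ = (k + n) z^{n+1} - n z^{n-1}`. -/
theorem hasDerivAt_act_hyp_monomial (k n : ℕ) (w : ℂ) :
    HasDerivAt (fun t : ℝ => act k (hyp t) (fun z => z ^ n) w)
      (((k : ℂ) + n) * w ^ (n + 1) - (n : ℂ) * w ^ (n - 1)) 0 := by
  simp_rw [act_hyp_monomial]
  -- the two factors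
  have h1 : HasDerivAt (fun t : ℝ => (Real.cosh t : ℂ) - (Real.sinh t : ℂ) * w)
      ((Real.sinh 0 : ℂ) - (Real.cosh 0 : ℂ) * w) 0 :=
    (hasDerivAt_cosh_ofReal 0).sub ((hasDerivAt_sinh_ofReal 0).mul_const w)
  have h2 : HasDerivAt (fun t : ℝ => (Real.cosh t : ℂ) * w - (Real.sinh t : ℂ))
      ((Real.sinh 0 : ℂ) * w - (Real.cosh 0 : ℂ)) 0 :=
    ((hasDerivAt_cosh_ofReal 0).mul_const w).sub (hasDerivAt_sinh_ofReal 0)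
  have hne : (Real.cosh 0 : ℂ) - (Real.sinh 0 : ℂ) * w ≠ 0 := by simp
  have h3 := ((h1.inv hne).pow (k + n)).mul (h2.pow n)
  refine h3.congr_deriv ?_
  simp only [Pi.inv_apply, Pi.pow_apply, Real.cosh_zero, Real.sinh_zero, Complex.ofReal_one,
    Complex.ofReal_zero, zero_mul, sub_zero, inv_one, one_pow, one_mul, mul_one, zero_sub,
    Nat.cast_add, neg_neg, div_one]
  rcases n with _ | m
  · simp
  · simp only [Nat.add_sub_cancel, Nat.cast_succ]
    ring

/-- **The second hyperbolic generator on monomials**: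
`d/dt|₀ π_k(b_t) zⁿ = -i ((k + n) z^{n+1} + n z^{n-1})`. -/
theorem hasDerivAt_act_hypB_monomial (k n : ℕ) (w : ℂ) :
    HasDerivAt (fun t : ℝ => act k (hypB t) (fun z => z ^ n) w)
      (-Complex.I * (((k : ℂ) + n) * w ^ (n + 1) + (n : ℂ) * w ^ (n - 1))) 0 := by
  simp_rw [act_hypB_monomial]
  have h1 : HasDerivAt (fun t : ℝ => (Real.cosh t : ℂ) + Complex.I * (Real.sinh t : ℂ) * w)
      ((Real.sinh 0 : ℂ) + Complex.I * (Real.cosh 0 : ℂ) * w) 0 :=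
    (hasDerivAt_cosh_ofReal 0).add (((hasDerivAt_sinh_ofReal 0).const_mul Complex.I).mul_const w)
  have h2 : HasDerivAt (fun t : ℝ => (Real.cosh t : ℂ) * w - Complex.I * (Real.sinh t : ℂ))
      ((Real.sinh 0 : ℂ) * w - Complex.I * (Real.cosh 0 : ℂ)) 0 :=
    ((hasDerivAt_cosh_ofReal 0).mul_const w).sub ((hasDerivAt_sinh_ofReal 0).const_mul Complex.I)
  have hne : (Real.cosh 0 : ℂ) + Complex.I * (Real.sinh 0 : ℂ) * w ≠ 0 := by simp
  have h3 := ((h1.inv hne).pow (k + n)).mul (h2.pow n)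
  refine h3.congr_deriv ?_
  simp only [Pi.inv_apply, Pi.pow_apply, Real.cosh_zero, Real.sinh_zero, Complex.ofReal_one,
    Complex.ofReal_zero, zero_mul, mul_zero, add_zero, sub_zero, inv_one, one_pow, one_mul, mul_one,
    zero_add, zero_sub, Nat.cast_add, div_one]
  rcases n with _ | m
  · simp only [Nat.cast_zero, add_zero, pow_zero, mul_one, zero_mul, Nat.zero_sub, zero_add]
    ring
  · simp only [Nat.add_sub_cancel, Nat.cast_succ]
    ring

/-- **The rotation generator on monomials**: `d/dt|₀ π_k(rot e^{it}) zⁿ = -i (k + 2n) zⁿ`. -/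
theorem hasDerivAt_act_rot_exp_monomial (k n : ℕ) (w : ℂ) :
    HasDerivAt (fun t : ℝ => act k (rot (Circle.exp t)) (fun z => z ^ n) w)
      (-Complex.I * ((k : ℂ) + 2 * n) * w ^ n) 0 := by
  have e : (fun t : ℝ => act k (rot (Circle.exp t)) (fun z => z ^ n) w) =
      fun t : ℝ => Complex.exp (-(((k : ℂ) + 2 * n) * Complex.I) * t) * w ^ n := by
    funext t
    rw [act_rot_monomial, Circle.coe_exp, ← Complex.exp_neg, ← Complex.exp_nat_mul]
    congr 2
    push_cast
    ring
  rw [e]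
  have h : HasDerivAt (fun t : ℝ => Complex.exp (-(((k : ℂ) + 2 * n) * Complex.I) * t))
      (Complex.exp (-(((k : ℂ) + 2 * n) * Complex.I) * (0 : ℝ)) * (-(((k : ℂ) + 2 * n) * Complex.I))) 0 := by
    have h0 : HasDerivAt (fun t : ℝ => -(((k : ℂ) + 2 * n) * Complex.I) * (t : ℂ))
        (-(((k : ℂ) + 2 * n) * Complex.I)) 0 := by
      simpa using (Complex.ofRealCLM.hasDerivAt (x := (0 : ℝ))).const_mul (-(((k : ℂ) + 2 * n) * Complex.I))
    exact (Complex.hasDerivAt_exp _).comp (0 : ℝ) h0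
  refine (h.mul_const (w ^ n)).congr_deriv ?_
  simp only [Complex.ofReal_zero, mul_zero, Complex.exp_zero, one_mul]
  ring

/-! ### The ladder operators -/

/-- The raising operator `E₊ := ½ (∂_a + i ∂_b)` on the monomial `zⁿ`: `E₊ zⁿ = (k + n) z^{n+1}`. -/
theorem raise_monomial (k n : ℕ) (w : ℂ) :
    (1 / 2 : ℂ) * ((((k : ℂ) + n) * w ^ (n + 1) - (n : ℂ) * w ^ (n - 1)) +
      Complex.I * (-Complex.I * (((k : ℂ) + n) * w ^ (n + 1) + (n : ℂ) * w ^ (n - 1)))) =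
      ((k : ℂ) + n) * w ^ (n + 1) := by
  ring_nf
  rw [Complex.I_sq]
  ring

/-- The lowering operator `E₋ := ½ (∂_a - i ∂_b)` on the monomial `zⁿ`: `E₋ zⁿ = -n z^{n-1}` — in
particular `E₋ 1 = 0`: the constant function is a lowest-weight vector. -/
theorem lower_monomial (k n : ℕ) (w : ℂ) :
    (1 / 2 : ℂ) * ((((k : ℂ) + n) * w ^ (n + 1) - (n : ℂ) * w ^ (n - 1)) -
      Complex.I * (-Complex.I * (((k : ℂ) + n) * w ^ (n + 1) + (n : ℂ) * w ^ (n - 1)))) =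
      -(n : ℂ) * w ^ (n - 1) := by
  ring_nf
  rw [Complex.I_sq]
  ring

/-- The weight operator `H := i ∂_rot` on `zⁿ`: `H zⁿ = (k + 2n) zⁿ`. -/
theorem weight_monomial (k n : ℕ) (w : ℂ) :
    Complex.I * (-Complex.I * ((k : ℂ) + 2 * n) * w ^ n) = ((k : ℂ) + 2 * n) * w ^ n := by
  ring_nf
  rw [Complex.I_sq]
  ring

/-- The raising coefficient `r_n = k + n` and the lowering coefficient `l_n = -n` of the ladder on the
basis `zⁿ`: `E₊ zⁿ = r_n z^{n+1}`, `E₋ zⁿ = l_n z^{n-1}`. -/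
noncomputable abbrev ladderUp (k n : ℕ) : ℂ := (k : ℂ) + n

/-- The lowering coefficient. -/
noncomputable abbrev ladderDown (n : ℕ) : ℂ := -(n : ℂ)

/-- **`E₊ E₋ zⁿ = -n (k + n - 1) zⁿ`** (for `n ≥ 1`; `0` for `n = 0`). -/
theorem raise_lower_monomial (k n : ℕ) (hn : 1 ≤ n) :
    ladderDown n * ladderUp k (n - 1) = -(n : ℂ) * ((k : ℂ) + n - 1) := by
  unfold ladderDown ladderUp
  obtain ⟨m, rfl⟩ := Nat.exists_eq_add_of_le' hn
  simp only [Nat.add_sub_cancel]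
  push_cast
  ring

/-- **`E₋ E₊ zⁿ = -(n + 1)(k + n) zⁿ`**. -/
theorem lower_raise_monomial (k n : ℕ) :
    ladderUp k n * ladderDown (n + 1) = -((n : ℂ) + 1) * ((k : ℂ) + n) := by
  unfold ladderDown ladderUp
  push_cast
  ring

/-- **`[E₊, E₋] zⁿ = (k + 2n) zⁿ = H zⁿ`**: the ladder satisfies the `𝔰𝔩₂` relation on every `K`-type. -/
theorem commutator_monomial (k n : ℕ) (hn : 1 ≤ n) :
    ladderDown n * ladderUp k (n - 1) - ladderUp k n * ladderDown (n + 1) = (k : ℂ) + 2 * n := by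
  rw [raise_lower_monomial k n hn, lower_raise_monomial]
  ring

/-- `[E₊, E₋] 1 = k · 1` (the `n = 0` case: `E₋ 1 = 0`). -/
theorem commutator_lowest (k : ℕ) : 0 - ladderUp k 0 * ladderDown 1 = (k : ℂ) := by
  unfold ladderDown ladderUp
  push_cast
  ring

/-- **The model is generated from the lowest-weight vector**: `E₊ⁿ 1 = k (k+1) ⋯ (k+n-1) · zⁿ`, with the
non-zero coefficient `∏_{j<n} (k + j) = (k + n - 1)! / (k - 1)!`. -/
theorem raise_iterate_lowest (k n : ℕ) :
    ∏ j ∈ Finset.range n, ladderUp k j = (Nat.ascFactorial k n : ℂ) := by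
  induction n with
  | zero => simp
  | succ m ih =>
    rw [Finset.prod_range_succ, ih, Nat.ascFactorial_succ]
    unfold ladderUp
    push_cast
    ring

/-- The coefficient `∏_{j<n} (k + j)` is non-zero for `k ≥ 1`: every `K`-type is reached from `1`. -/
theorem raise_iterate_lowest_ne_zero (k n : ℕ) (hk : 1 ≤ k) :
    ∏ j ∈ Finset.range n, ladderUp k j ≠ 0 := by
  rw [raise_iterate_lowest]
  obtain ⟨k', rfl⟩ := Nat.exists_eq_add_of_le' hk
  exact_mod_cast (Nat.ascFactorial_pos k' n).ne'

end Summit.Ventures.HodgeRepro2.T5BergmanLadder
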